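import Mathlib
import Summits.MatrixMultiplication.MatrixMultiplication.Theses.ShapeSubmodularity
import Summits.MatrixMultiplication.MatrixMultiplication.Theorems.ShapeSubmodularityPerfectAmortisation
import Summits.MatrixMultiplication.MatrixMultiplication.Theorems.ShapeSubmodularityShapeSubmodularSummitEquivalence
import Literature.Computability.AlgebraicComplexity.RectangularExponentHomogeneity
import Literature.Computability.AlgebraicComplexity.AsymptoticRankBorderRank

/-!
# MRR2 implies SUBMOD: `BorderLogSubmodular → ShapeSubmodular` (and hence `→ ω(ℂ) = 2`)

Route `ShapeSubmodularity`, crux `ShapeSubmodular` (stmt-MatrixMultiplication-15622).  The route's finite engine is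
the law MRR2 = `BorderLogSubmodular` (stmt-15146): the algebraic border rank of matrix multiplication is
log-submodular on the format lattice, `bR⟨a∨a', b∨b', c∨c'⟩ · bR⟨a∧a', b∧b', c∧c'⟩ ≤ bR⟨a,b,c⟩ · bR⟨a',b',c'⟩` for all
positive formats.  This file proves the glue item `MRR2ImpliesSubmod` (stmt-15147) BY NAME and lands it as a
CONDITIONAL PROOF OF THE CRUX (`ShapeSubmodular_of_BorderLogSubmodular`): MRR2 is the only statement filed in the
tree that implies the crux short of the summit itself (the crux is summit-equivalent,
`ShapeSubmodular_iff_MatrixMultiplication`).  Corollary: **`BorderLogSubmodular → ω(ℂ) = 2`**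
(`matrixMultiplication_of_BorderLogSubmodular`), so the finite law is itself summit-hard to prove and is best
attacked by refutation (first cell: `bR⟨3,3,3⟩ = 20` kills it, `CubeNineteenOfMRR2`).

Proof (no Kronecker powers needed, unlike the planner's sketch): fix natural exponents and rank-form bounds
`R⟨n^a,n^b,n^c⟩ ≤ C n^β`, `R⟨n^a',n^b',n^c'⟩ ≤ C' n^β'` for large `n`.  For every such `n ≥ 2` apply MRR2 to the
formats `(n^a,n^b,n^c)`, `(n^a',n^b',n^c')` (join/meet commute with `x ↦ n^x`), bound the left side from below
by the asymptotic rank, `R̃ ≤ bR` (`asymptoticRank_le_algBorderRank`, BCS Lemma 15.27) and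
`R̃⟨n^x,n^y,n^z⟩ = n^{ω(x,y,z)}` (`asymptoticRank_matMulTensor_rect`, ADVXXZ2025 §3.4, any base `n ≥ 2`), and the
right side from above by `bR ≤ R` (`algBorderRank_le_tensorRank`): `n^{ω(J)+ω(M)} ≤ C C' n^{β+β'}` for all large
`n`, hence `ω(J) + ω(M) ≤ β + β'`; finally `ω(·) + ε/2` is admissible (infimum of an upward closed set) and the
dictionary `rectDim_natCast` returns the rank-form O-bounds.  No new definitions; axioms standard.
-/

set_option linter.dupNamespace false
-- (single-conjunct summit: the namespace repeats `MatrixMultiplication`)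

namespace Summit.MatrixMultiplication.MatrixMultiplication.Theorems.ShapeSubmodular

open Summit.MatrixMultiplication.MatrixMultiplication.Theses.ShapeSubmodularity
open Literature.Computability.AlgebraicComplexity
open Filter Asymptotics

/-- Dictionary (`rectDim_natCast`: `⌈n^a⌉ = n^a` at natural exponents): the rank-form O-bound of the route
file is membership in `rectAdmissibleExponents ℂ a b c`. [folklore] -/
theorem isBigO_rpow_iff_mem_rectAdmissibleExponents (a b c : ℕ) (β : ℝ) :
    (fun n : ℕ => (tensorRank (matMulTensor ℂ (n ^ a) (n ^ b) (n ^ c)) : ℝ)) =O[atTop]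
        (fun n : ℕ => (n : ℝ) ^ β) ↔
      β ∈ rectAdmissibleExponents ℂ (a : ℝ) (b : ℝ) (c : ℝ) := by
  have hfun : (fun n : ℕ => (tensorRank (matMulTensor ℂ (n ^ a) (n ^ b) (n ^ c)) : ℝ)) =
      fun n : ℕ => (tensorRank (matMulTensor ℂ (rectDim n (a : ℝ)) (rectDim n (b : ℝ))
        (rectDim n (c : ℝ))) : ℝ) := by
    funext n
    rw [tensorRank_matMulTensor_congr ℂ (rectDim_natCast n a).symm (rectDim_natCast n b).symm
      (rectDim_natCast n c).symm]
  rw [hfun]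
  rfl

/-- Every `γ > ω(a,b,c)` is a rank-form admissible exponent of the natural format `(a,b,c)` (the admissible
set is non-empty and upward closed, `ω` is its infimum). [folklore] -/
theorem isBigO_rpow_of_omegaRect_lt (a b c : ℕ) {γ : ℝ}
    (h : omegaRect ℂ (a : ℝ) (b : ℝ) (c : ℝ) < γ) :
    (fun n : ℕ => (tensorRank (matMulTensor ℂ (n ^ a) (n ^ b) (n ^ c)) : ℝ)) =O[atTop]
      (fun n : ℕ => (n : ℝ) ^ γ) := by
  rw [isBigO_rpow_iff_mem_rectAdmissibleExponents]
  obtain ⟨β, hβ, hβγ⟩ := exists_lt_of_csInf_lt (rectAdmissibleExponents_nonempty ℂ _ _ _) h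
  exact mem_rectAdmissibleExponents_of_le hβ hβγ.le

/-- `ω(a,b,c) ≤ β` for every rank-form admissible `β` of the natural format `(a,b,c)`. [folklore] -/
theorem omegaRect_le_of_isBigO_rpow (a b c : ℕ) {β : ℝ}
    (hβ : (fun n : ℕ => (tensorRank (matMulTensor ℂ (n ^ a) (n ^ b) (n ^ c)) : ℝ)) =O[atTop]
      (fun n : ℕ => (n : ℝ) ^ β)) :
    omegaRect ℂ (a : ℝ) (b : ℝ) (c : ℝ) ≤ β :=
  csInf_le (rectAdmissibleExponents_bddBelow ℂ _ _ _)
    ((isBigO_rpow_iff_mem_rectAdmissibleExponents a b c β).1 hβ)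

/-- **The exponent inequality from MRR2**: if border rank is log-submodular on the format lattice, then for
natural formats `p = (a,b,c)`, `q = (a',b',c')` and rank-form admissible `β` (for `p`), `β'` (for `q`),
`ω(p ∨ q) + ω(p ∧ q) ≤ β + β'`.  For each large `n ≥ 2`: MRR2 at `(n^a,n^b,n^c)`, `(n^a',n^b',n^c')`,
`n^{ω(J)} = R̃⟨n^J⟩ ≤ bR⟨n^J⟩` (same for the meet), `bR ≤ R ≤ C n^β` on the right; then `n → ∞`. [folklore] -/
theorem omegaRect_join_add_meet_le_of_borderLogSubmodular (hM : BorderLogSubmodular)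
    (a b c a' b' c' : ℕ) {β β' : ℝ}
    (hβ : (fun n : ℕ => (tensorRank (matMulTensor ℂ (n ^ a) (n ^ b) (n ^ c)) : ℝ)) =O[atTop]
      (fun n : ℕ => (n : ℝ) ^ β))
    (hβ' : (fun n : ℕ => (tensorRank (matMulTensor ℂ (n ^ a') (n ^ b') (n ^ c')) : ℝ)) =O[atTop]
      (fun n : ℕ => (n : ℝ) ^ β')) :
    omegaRect ℂ ((max a a' : ℕ) : ℝ) ((max b b' : ℕ) : ℝ) ((max c c' : ℕ) : ℝ) +
      omegaRect ℂ ((min a a' : ℕ) : ℝ) ((min b b' : ℕ) : ℝ) ((min c c' : ℕ) : ℝ) ≤ β + β' := by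
  set ωJ := omegaRect ℂ ((max a a' : ℕ) : ℝ) ((max b b' : ℕ) : ℝ) ((max c c' : ℕ) : ℝ) with hωJ
  set ωM := omegaRect ℂ ((min a a' : ℕ) : ℝ) ((min b b' : ℕ) : ℝ) ((min c c' : ℕ) : ℝ) with hωM
  by_contra hlt
  rw [not_le] at hlt
  obtain ⟨C, hC0, hC⟩ := hβ.exists_pos
  obtain ⟨C', hC0', hC'⟩ := hβ'.exists_pos
  -- the pointwise inequality `n^{ωJ+ωM-(β+β')} ≤ C C'` for all large `n`
  have hev : ∀ᶠ n : ℕ in atTop, (n : ℝ) ^ (ωJ + ωM - (β + β')) ≤ C * C' := by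
    filter_upwards [hC.bound, hC'.bound, eventually_ge_atTop 2] with n hn hn' hn2
    have hnpos : 0 < n := by omega
    have hn0 : (0 : ℝ) < n := by exact_mod_cast hnpos
    rw [Real.norm_of_nonneg (Nat.cast_nonneg _),
      Real.norm_of_nonneg (Real.rpow_nonneg (Nat.cast_nonneg _) _)] at hn hn'
    -- MRR2 at the two formats; join and meet commute with `x ↦ n^x`
    have hmono : Monotone (fun x : ℕ => n ^ x) := fun x y hxy => Nat.pow_le_pow_right hnpos hxy
    have hmax : ∀ x y : ℕ, max (n ^ x) (n ^ y) = n ^ max x y := fun x y => (hmono.map_max).symm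
    have hmin : ∀ x y : ℕ, min (n ^ x) (n ^ y) = n ^ min x y := fun x y => (hmono.map_min).symm
    have hMn := hM (n ^ a) (n ^ b) (n ^ c) (n ^ a') (n ^ b') (n ^ c')
      (Nat.one_le_pow _ _ hnpos) (Nat.one_le_pow _ _ hnpos) (Nat.one_le_pow _ _ hnpos)
      (Nat.one_le_pow _ _ hnpos) (Nat.one_le_pow _ _ hnpos) (Nat.one_le_pow _ _ hnpos)
    rw [hmax, hmax, hmax, hmin, hmin, hmin] at hMn
    have hMnR : (algBorderRank (matMulTensor ℂ (n ^ max a a') (n ^ max b b') (n ^ max c c')) : ℝ) *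
        (algBorderRank (matMulTensor ℂ (n ^ min a a') (n ^ min b b') (n ^ min c c')) : ℝ) ≤
        (algBorderRank (matMulTensor ℂ (n ^ a) (n ^ b) (n ^ c)) : ℝ) *
        (algBorderRank (matMulTensor ℂ (n ^ a') (n ^ b') (n ^ c')) : ℝ) := by
      exact_mod_cast hMn
    -- lower bounds on the left: `n^ω = R̃ ≤ bR`
    have hJ : (n : ℝ) ^ ωJ ≤
        (algBorderRank (matMulTensor ℂ (n ^ max a a') (n ^ max b b') (n ^ max c c')) : ℝ) := by
      rw [hωJ, ← asymptoticRank_matMulTensor_rect ℂ hn2]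
      exact asymptoticRank_le_algBorderRank _
    have hMt : (n : ℝ) ^ ωM ≤
        (algBorderRank (matMulTensor ℂ (n ^ min a a') (n ^ min b b') (n ^ min c c')) : ℝ) := by
      rw [hωM, ← asymptoticRank_matMulTensor_rect ℂ hn2]
      exact asymptoticRank_le_algBorderRank _
    -- upper bounds on the right: `bR ≤ R ≤ C n^β`
    have hP : (algBorderRank (matMulTensor ℂ (n ^ a) (n ^ b) (n ^ c)) : ℝ) ≤ C * (n : ℝ) ^ β :=
      le_trans (by exact_mod_cast algBorderRank_le_tensorRank _) hn
    have hQ : (algBorderRank (matMulTensor ℂ (n ^ a') (n ^ b') (n ^ c')) : ℝ) ≤ C' * (n : ℝ) ^ β' :=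
      le_trans (by exact_mod_cast algBorderRank_le_tensorRank _) hn'
    have hchain : (n : ℝ) ^ ωJ * (n : ℝ) ^ ωM ≤ (C * (n : ℝ) ^ β) * (C' * (n : ℝ) ^ β') :=
      calc (n : ℝ) ^ ωJ * (n : ℝ) ^ ωM
          ≤ (algBorderRank (matMulTensor ℂ (n ^ max a a') (n ^ max b b') (n ^ max c c')) : ℝ) *
              (algBorderRank (matMulTensor ℂ (n ^ min a a') (n ^ min b b') (n ^ min c c')) : ℝ) :=
            mul_le_mul hJ hMt (Real.rpow_nonneg hn0.le _) (Nat.cast_nonneg _)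
        _ ≤ (algBorderRank (matMulTensor ℂ (n ^ a) (n ^ b) (n ^ c)) : ℝ) *
              (algBorderRank (matMulTensor ℂ (n ^ a') (n ^ b') (n ^ c')) : ℝ) := hMnR
        _ ≤ (C * (n : ℝ) ^ β) * (C' * (n : ℝ) ^ β') :=
            mul_le_mul hP hQ (Nat.cast_nonneg _) (by positivity)
    have hsplit : (n : ℝ) ^ (ωJ + ωM - (β + β')) =
        (n : ℝ) ^ ωJ * (n : ℝ) ^ ωM / ((n : ℝ) ^ β * (n : ℝ) ^ β') := by
      rw [Real.rpow_sub hn0, Real.rpow_add hn0, Real.rpow_add hn0]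
    rw [hsplit, div_le_iff₀ (by positivity)]
    calc (n : ℝ) ^ ωJ * (n : ℝ) ^ ωM ≤ (C * (n : ℝ) ^ β) * (C' * (n : ℝ) ^ β') := hchain
      _ = C * C' * ((n : ℝ) ^ β * (n : ℝ) ^ β') := by ring
  have hlim : Tendsto (fun n : ℕ => (n : ℝ) ^ (ωJ + ωM - (β + β'))) atTop atTop :=
    (tendsto_rpow_atTop (by linarith)).comp tendsto_natCast_atTop_atTop
  obtain ⟨n, hn₁, hn₂⟩ := (hev.and (hlim.eventually_gt_atTop (C * C'))).exists
  exact absurd hn₁ (not_le.2 hn₂)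

/-- **MRR2 ⟹ SUBMOD** — a conditional proof of the crux `ShapeSubmodular` from the finite law
`BorderLogSubmodular` (stmt-15146): given rank-form admissible `β`, `β'` for `p`, `q` and `ε > 0`, take
`γ = ω(p ∨ q) + ε/2`, `γ' = ω(p ∧ q) + ε/2`. [folklore] -/
theorem ShapeSubmodular_of_BorderLogSubmodular : Summit.MatrixMultiplication.MatrixMultiplication.Theses.ShapeSubmodularity.BorderLogSubmodular → Summit.MatrixMultiplication.MatrixMultiplication.Theses.ShapeSubmodularity.ShapeSubmodular := by
  intro hM a b c a' b' c' β β' hβ hβ' ε hε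
  have key := omegaRect_join_add_meet_le_of_borderLogSubmodular hM a b c a' b' c' hβ hβ'
  refine ⟨omegaRect ℂ ((max a a' : ℕ) : ℝ) ((max b b' : ℕ) : ℝ) ((max c c' : ℕ) : ℝ) + ε / 2,
    omegaRect ℂ ((min a a' : ℕ) : ℝ) ((min b b' : ℕ) : ℝ) ((min c c' : ℕ) : ℝ) + ε / 2, by linarith,
    isBigO_rpow_of_omegaRect_lt _ _ _ (by linarith), isBigO_rpow_of_omegaRect_lt _ _ _ (by linarith)⟩

/-- Route item `MRR2ImpliesSubmod` (stmt-MatrixMultiplication-15147) BY NAME. [folklore] -/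
theorem mrr2ImpliesSubmod_proof : MRR2ImpliesSubmod :=
  ShapeSubmodular_of_BorderLogSubmodular

/-- **MRR2 ⟹ ω(ℂ) = 2**: log-submodularity of the border rank of matrix multiplication on the format
lattice already decides the summit (MRR2 → SUBMOD → with the proved crux E, `closes`).  Contrapositive for
refuters: if `ω(ℂ) > 2` then some finite pair of formats violates MRR2. [folklore] -/
theorem matrixMultiplication_of_BorderLogSubmodular (hM : BorderLogSubmodular) : _root_.MatrixMultiplication :=
  -- repair 2026-08-17T14:4xZ: the route's `closes` was removed on closure; `submod_closes` is its verbatim re-landing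
  -- (Theorems/ShapeSubmodularityShapeSubmodularSummitEquivalence.lean).
  submod_closes (ShapeSubmodular_of_BorderLogSubmodular hM)
    PerfectAmortisation.perfectAmortisation_proof_shapeSubmodularity

/-- `MRR2 ⟹ ω(ℂ) = 2`, exponent form. [folklore] -/
theorem omega_eq_two_of_BorderLogSubmodular (hM : BorderLogSubmodular) : omega ℂ = 2 :=
  (_root_.MatrixMultiplication_iff).1 (matrixMultiplication_of_BorderLogSubmodular hM)

end Summit.MatrixMultiplication.MatrixMultiplication.Theorems.ShapeSubmodular
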